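import Literature.Barriers.AtomisticToContinuum.DisorderedHarmonicChainPotential
import Mathlib.Analysis.Calculus.Deriv.MeanValue
import Mathlib.Analysis.Calculus.Deriv.Shift
import Mathlib.Analysis.Calculus.ContDiff.Deriv
import Mathlib.Analysis.Calculus.IteratedDeriv.Defs
import Mathlib.Algebra.Order.Round
import HarnessLib

/-!
# Ajanki–Huveneers 2011, Lemma 5.3 (estimates on `R_y`): the printed bound (5.12) is false; the corrected bound, proved

Sixth file of the Casher–Lebowitz / Ajanki–Huveneers cluster (O. Ajanki, F. Huveneers, *Rigorous
scaling law for the heat current in disordered harmonic chain*, CMP **301** (2011) 841–883,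
arXiv:1003.1076); provefact unit for the named fact `AjankiHuveneers2011_RyEstimate`
(`DisorderedHarmonicChainPotential.lean`), which transcribes Lemma 5.3, eq. (5.12):

  "There exists `K > 0` such that, for every `u ∈ C²(𝕋)` and every `y ∈ 𝕋`,
  `‖R_y u‖_∞ ≤ K w² {‖sin π(· - y - w) · u'‖_∞ + w‖u'‖_∞ + ‖sin² π(· - y - w) · u''‖_∞ + w‖u''‖_∞}`."

## The printed statement is false

The printed proof applies the mean value theorem to `u ∘ f_b(x) - u ∘ g_b(x,y)` and writes the
intermediate point as `x + w + ξ₁` with (5.13) "`|ξ₁| ≤ w|φ(x) - φ(y)| + 𝒪(w²)`". But `x + w + ξ₁`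
lies between `g_b(x,y) = x + ϑ + Φ(y,b)` and `f_b(x) = x + ϑ + Φ(x,b)`, and
`Φ(y,b) = w sin²(πy) b + 𝒪(w²)` is of order `w`, not `w|φ(x) - φ(y)| + w²`; so `ξ₁ = 𝒪(w)` only.
The cross term `∫ u''(x + w + ξ₂) ξ₁ · w[φ(x) - φ(y)] b τ̃(b) db` of the proof is therefore only
`≲ w² |sin π(x-y)| · |u''|` — ONE power of the sine — and, depending on `b` through `u''(ξ₂(b))`,
it is not killed by `∫ b τ(b) db = 0`.

The statement itself fails, not only its proof. Take `h = 0`, `τ` uniform on `[-1/2, 1/2]`,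
`y = 1/4`, `x = y + t`, `u(z) = cos^{2N}(π(z - x - ϑ))` with `N = t⁻²`, and `w = t³`. Then
`R_y u(x) = 𝔼[u(x + ϑ + Φ(x,B)) - u(x + ϑ + Φ(y,B))] = -Nπ² 𝔼[Φ(x,B)² - Φ(y,B)²] + 𝒪(N²w⁴)
= -π³ 𝔼(B²) w²/t + o(w²/t)`, whereas the four sup-norms on the right of (5.12) stay bounded
(`‖sin π(·-y-w) u'‖_∞ ≲ 1`, `w‖u'‖_∞ ≲ w/t`, `‖sin² π(·-y-w) u''‖_∞ ≲ 1`, `w‖u''‖_∞ ≲ w/t²`), so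
the right-hand side is `𝒪(K w²)`: the ratio grows like `1/t`. (Numerically the ratio doubles
with each halving of `t`: `0.077, 0.151, 0.278, 0.524, 1.013` for `t = 0.2 … 0.0125`, while with
`sin` in place of `sin²` on `u''` it is `0.047, 0.050, 0.047, 0.044, 0.043`.)

## What is true, and proved here

Replacing `‖sin² π(· - y - w) · u''‖_∞` by `‖sin π(· - y - w) · u''‖_∞` gives a correct lemma,
`AjankiHuveneers2011_RyEstimateCorrected`, PROVED below (`…_holds`) along the lines of the
printed proof with the error repaired:
`R_y u(x) = ∫ [u(a_b + d_b) - u(a_b)] τ̃(b) db + w(h(x) - h(y)) ∫ [u(a_b) - u(c)] b τ(b) db` with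
`c = x + ϑ`, `a_b = g_b(x,y) = c + Φ(y,b)`, `d_b = Φ(x,b) - Φ(y,b)`, `τ̃ = (1 + wh(x)b)τ`
(using `∫ b τ = 0`); two mean value steps give
`u(a+d) - u(a) - u'(c)d = u''(θ₂)(θ₁ - c)d` with `|θ₁ - c| ≤ 3 sup|Φ| ≲ w`; the inputs on `Φ`
are consequences of the proved expansion (3.11) (`ahPhi_expansion`):
`|Φ| ≲ w`, `|Φ(x,b) - Φ(y,b)| ≲ w(|sin π(x-y)| + w²)`, `|∫ d_b τ̃(b) db| ≲ w²(|sin π(x-y)| + w)`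
(the last from `∫ b τ = 0`); `|h(x) - h(y)| ≤ ½‖h'‖_∞ |sin π(x-y)|` for `1`-periodic `h`; and
`|sin π(x-y)| ≤ |sin π(θ - y - w)| + π|x + w - θ|` moves the sine weight onto the intermediate
points (`|x + w - θ| ≲ w` since `w ≤ ϑ ≤ w + w³`).

The printed fact is formally STRONGER than the corrected one (`sin² ≤ |sin|`, so every majorant
admissible in the corrected statement is admissible in the printed one):
`AjankiHuveneers2011_RyEstimate → AjankiHuveneers2011_RyEstimateCorrected`
(`AjankiHuveneers2011_RyEstimate.corrected`; the printed fact is, since the verdict clean-up of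
2026-08-16, a `@[deprecated]` record of `DisorderedHarmonicChainPotential.lean`, whence the one
`set_option linter.deprecated false in` below). Downstream (proof of Prop. 5.1, Step 1) the printed
(5.12) is applied to `S_{y,k-1}v` through (5.9)–(5.10); with the corrected lemma the term
`w²‖sin π(·) ∂²S_{y,k}v‖_∞` is `≲ ‖v‖₁/k` (interpolating (5.9), `l = 2`, and (5.10), `k = 2`), whose
sum over `k ≤ n ≤ w⁻²` is `≲ ‖v‖₁ log w⁻¹`, not `≲ ‖v‖₁`: the assembly of Prop. 5.1 cannot use
Lemma 5.3 as printed and must either find the extra cancellation or carry the logarithm.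

## Sources

O. Ajanki, F. Huveneers, CMP 301 (2011) 841–883, arXiv:1003.1076: §5 Lemma 5.3, eqs.
(5.12)–(5.13) and its proof; Lemma 3.2 eq. (3.11); Lemma 3.1 eq. (3.4).
-/

noncomputable section

open MeasureTheory Real Set

namespace Literature.Barriers.AtomisticToContinuum.HeatConduction

/-! ### Elementary real-analysis helpers -/

/-- Mean value theorem on an unordered pair of points: `f p - f q = f'(θ)(p - q)` for some `θ`
between `p` and `q`. [folklore] -/
theorem exists_deriv_mul_sub_of_differentiable {f : ℝ → ℝ} (hf : Differentiable ℝ f) (p q : ℝ) :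
    ∃ θ ∈ Set.uIcc p q, f p - f q = deriv f θ * (p - q) := by
  rcases lt_trichotomy q p with h | h | h
  · obtain ⟨c, hc, hcd⟩ :=
      exists_deriv_eq_slope f h hf.continuous.continuousOn (hf.differentiableOn)
    refine ⟨c, ?_, ?_⟩
    · rw [Set.uIcc_comm, Set.uIcc_of_le h.le]
      exact Set.Ioo_subset_Icc_self hc
    · rw [hcd]
      field_simp
  · subst h
    exact ⟨q, Set.left_mem_uIcc, by simp⟩
  · obtain ⟨c, hc, hcd⟩ :=
      exists_deriv_eq_slope f h hf.continuous.continuousOn (hf.differentiableOn)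
    refine ⟨c, ?_, ?_⟩
    · rw [Set.uIcc_of_le h.le]
      exact Set.Ioo_subset_Icc_self hc
    · rw [hcd]
      field_simp
      ring

/-- A point of `[[p, q]]` is within `max |p - c| |q - c|` of any `c`. [folklore] -/
theorem abs_sub_le_max_of_mem_uIcc {θ p q : ℝ} (hθ : θ ∈ Set.uIcc p q) (c : ℝ) :
    |θ - c| ≤ max |p - c| |q - c| := by
  rcases Set.mem_uIcc.mp hθ with ⟨h1, h2⟩ | ⟨h1, h2⟩
  · rw [abs_le]
    constructor
    · have := neg_abs_le (p - c)
      have := le_max_left |p - c| |q - c|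
      linarith
    · have := le_abs_self (q - c)
      have := le_max_right |p - c| |q - c|
      linarith
  · rw [abs_le]
    constructor
    · have := neg_abs_le (q - c)
      have := le_max_right |p - c| |q - c|
      linarith
    · have := le_abs_self (p - c)
      have := le_max_left |p - c| |q - c|
      linarith

/-- A `1`-periodic differentiable function with `|h'| ≤ L` satisfies
`|h(x) - h(y)| ≤ (L/2)|sin π(x - y)|` ("`|h(x) - h(y)| ≲ |sin π(x-y)|`").
[cite: AjankiHuveneers2011, proof of Lemma 5.3] -/
theorem periodic_abs_sub_le_sin {h : ℝ → ℝ} (hp : Function.Periodic h 1) (hd : Differentiable ℝ h)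
    {L : ℝ} (hL : ∀ z, |deriv h z| ≤ L) (x y : ℝ) :
    |h x - h y| ≤ L / 2 * |Real.sin (π * (x - y))| := by
  set n : ℤ := round (x - y) with hn
  set s : ℝ := x - y - n with hs
  have hL0 : 0 ≤ L := (abs_nonneg _).trans (hL 0)
  have hxs : h x = h (y + s) := by
    have h1 : x = y + s + (n : ℤ) * (1 : ℝ) := by rw [hs]; ring
    conv_lhs => rw [h1]
    exact hp.int_mul n (y + s)
  obtain ⟨θ, -, hθ⟩ := exists_deriv_mul_sub_of_differentiable hd (y + s) y
  have h2 : |h (y + s) - h y| ≤ L * |s| := by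
    rw [hθ, abs_mul, add_sub_cancel_left]
    exact mul_le_mul_of_nonneg_right (hL θ) (abs_nonneg _)
  -- `2 |t - round t| ≤ |sin πt|` (Jordan's inequality on `[-1/2, 1/2]`; the same elementary fact is
  -- `Literature.NumberTheory.LFunctions.SiegelIntegral.two_mul_abs_sub_round_le_abs_sin`, not imported
  -- here to keep the harmonic-chain cluster free of the Riemann–Siegel files)
  have h3 : 2 * |s| ≤ |Real.sin (π * (x - y))| := by
    have hs_abs : |s| ≤ 1 / 2 := by rw [hs, hn]; exact abs_sub_round (x - y)
    have hsin : |Real.sin (π * (x - y))| = |Real.sin (π * s)| := by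
      have : π * (x - y) = π * s + (n : ℤ) * π := by rw [hs]; ring
      rw [this, Real.sin_add_int_mul_pi, abs_mul, abs_zpow, abs_neg, abs_one, one_zpow, one_mul]
    rw [hsin]
    rcases le_or_gt 0 s with h0 | h0
    · have h1 : π * s ≤ π / 2 := by nlinarith [Real.pi_pos, (abs_le.mp hs_abs).2]
      have h2 := Real.mul_le_sin (by positivity : 0 ≤ π * s) h1
      rw [abs_of_nonneg h0]
      have h3 : 2 / π * (π * s) = 2 * s := by field_simp
      rw [h3] at h2
      exact h2.trans (le_abs_self _)
    · have h1 : π * (-s) ≤ π / 2 := by nlinarith [Real.pi_pos, (abs_le.mp hs_abs).1]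
      have h2 := Real.mul_le_sin (by nlinarith [Real.pi_pos] : 0 ≤ π * (-s)) h1
      rw [abs_of_neg h0]
      have h3 : 2 / π * (π * (-s)) = 2 * (-s) := by field_simp
      rw [h3] at h2
      rw [mul_neg, mul_neg, Real.sin_neg] at h2
      calc 2 * -s = -(2 * s) := by ring
        _ ≤ -Real.sin (π * s) := h2
        _ ≤ |Real.sin (π * s)| := neg_le_abs _
  rw [hxs]
  calc |h (y + s) - h y| ≤ L * |s| := h2
    _ ≤ L / 2 * |Real.sin (π * (x - y))| := by nlinarith

/-- Moving a sine weight from `x` to a nearby point `z`: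
`|sin π(x-y)| |v| ≤ |sin π(z-y-w) v| + π|x + w - z| |v|`. [cite: AjankiHuveneers2011, proof of Lemma 5.3
("`sin²π(x-y) ≤ sin²π(x + ξ₂ - y) + 𝒪(w)`")] -/
theorem abs_sin_mul_le_shift (x y w z v : ℝ) :
    |Real.sin (π * (x - y))| * |v| ≤
      |Real.sin (π * (z - y - w)) * v| + π * |x + w - z| * |v| := by
  have h1 : |Real.sin (π * (x - y))| ≤ |Real.sin (π * (z - y - w))| + π * |x + w - z| := by
    have h2 := Real.abs_sin_sub_sin_le (π * (x - y)) (π * (z - y - w))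
    have h3 : |π * (x - y) - π * (z - y - w)| = π * |x + w - z| := by
      rw [show π * (x - y) - π * (z - y - w) = π * (x + w - z) by ring, abs_mul,
        abs_of_pos Real.pi_pos]
    rw [h3] at h2
    have := abs_sub_abs_le_abs_sub (Real.sin (π * (x - y))) (Real.sin (π * (z - y - w)))
    linarith
  rw [abs_mul]
  nlinarith [abs_nonneg v, abs_nonneg (Real.sin (π * (z - y - w)))]

/-- `sin²a - sin²b = sin(a-b) sin(a+b)`. [folklore] -/
theorem sin_sq_sub_sin_sq_eq (a b : ℝ) :
    Real.sin a ^ 2 - Real.sin b ^ 2 = Real.sin (a - b) * Real.sin (a + b) := by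
  rw [Real.sin_sub, Real.sin_add]
  have ha := Real.cos_sq' a
  have hb := Real.cos_sq' b
  nlinarith [ha, hb]

/-- `|sin²(πx) - sin²(πy)| ≤ |sin π(x-y)|` ("`|φ(x) - φ(y)| ≲ |sin π(x-y)|`, `φ = sin² π·`).
[cite: AjankiHuveneers2011, proof of Lemma 5.3] -/
theorem abs_sin_sq_sub_sin_sq_le (x y : ℝ) :
    |Real.sin (π * x) ^ 2 - Real.sin (π * y) ^ 2| ≤ |Real.sin (π * (x - y))| := by
  rw [sin_sq_sub_sin_sq_eq, ← mul_sub, abs_mul]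
  exact mul_le_of_le_one_right (abs_nonneg _) (Real.abs_sin_le_one _)

/-- `sin²(a) sin(2a) = sin(2a)/2 - sin(4a)/4`. [folklore] -/
theorem sin_sq_mul_sin_two_mul (a : ℝ) :
    Real.sin a ^ 2 * Real.sin (2 * a) = Real.sin (2 * a) / 2 - Real.sin (4 * a) / 4 := by
  have h4 : Real.sin (4 * a) = 2 * Real.sin (2 * a) * Real.cos (2 * a) := by
    rw [show 4 * a = 2 * (2 * a) by ring, Real.sin_two_mul]
  rw [h4, Real.cos_two_mul, Real.cos_sq']
  ring

/-- `|sin²(πx) sin(2πx) - sin²(πy) sin(2πy)| ≤ 2|sin π(x-y)|` ("`|ψ(x) - ψ(y)| ≲ |sin π(x-y)|`" for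
the second-order coefficient of `Φ`). [cite: AjankiHuveneers2011, proof of Lemma 5.3] -/
theorem abs_sin_sq_mul_sin_sub_le (x y : ℝ) :
    |Real.sin (π * x) ^ 2 * Real.sin (2 * π * x) - Real.sin (π * y) ^ 2 * Real.sin (2 * π * y)| ≤
      2 * |Real.sin (π * (x - y))| := by
  have hx := sin_sq_mul_sin_two_mul (π * x)
  have hy := sin_sq_mul_sin_two_mul (π * y)
  rw [show 2 * π * x = 2 * (π * x) by ring, show 2 * π * y = 2 * (π * y) by ring, hx, hy]
  have h1 : Real.sin (2 * (π * x)) - Real.sin (2 * (π * y)) =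
      2 * Real.sin (π * (x - y)) * Real.cos (π * (x + y)) := by
    rw [Real.sin_sub_sin]; congr 2 <;> [congr 1; congr 1] <;> ring
  have h2 : Real.sin (4 * (π * x)) - Real.sin (4 * (π * y)) =
      2 * (2 * Real.sin (π * (x - y)) * Real.cos (π * (x - y))) * Real.cos (2 * (π * (x + y))) := by
    rw [Real.sin_sub_sin, ← Real.sin_two_mul]; congr 2 <;> [congr 1; congr 1] <;> ring
  have e : Real.sin (2 * (π * x)) / 2 - Real.sin (4 * (π * x)) / 4 -
      (Real.sin (2 * (π * y)) / 2 - Real.sin (4 * (π * y)) / 4) =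
      Real.sin (π * (x - y)) * (Real.cos (π * (x + y)) -
        Real.cos (π * (x - y)) * Real.cos (2 * (π * (x + y)))) := by
    have : Real.sin (2 * (π * x)) / 2 - Real.sin (4 * (π * x)) / 4 -
        (Real.sin (2 * (π * y)) / 2 - Real.sin (4 * (π * y)) / 4) =
        (Real.sin (2 * (π * x)) - Real.sin (2 * (π * y))) / 2 -
          (Real.sin (4 * (π * x)) - Real.sin (4 * (π * y))) / 4 := by ring
    rw [this, h1, h2]; ring
  rw [e, abs_mul, mul_comm]
  refine mul_le_mul_of_nonneg_right ?_ (abs_nonneg _)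
  have c1 := Real.abs_cos_le_one (π * (x + y))
  have c2 := Real.abs_cos_le_one (π * (x - y))
  have c3 := Real.abs_cos_le_one (2 * (π * (x + y)))
  calc |Real.cos (π * (x + y)) - Real.cos (π * (x - y)) * Real.cos (2 * (π * (x + y)))|
      ≤ |Real.cos (π * (x + y))| + |Real.cos (π * (x - y)) * Real.cos (2 * (π * (x + y)))| :=
        abs_sub _ _
    _ ≤ 1 + 1 := by
        rw [abs_mul]
        exact add_le_add c1 (mul_le_one₀ c2 (abs_nonneg _) c3)
    _ = 2 := by norm_num


/-! ### Consequences of the expansion (3.11) of `Φ` -/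

section PhiBounds

variable {τ : ℝ → ℝ} (bm bp : ℝ)

/-- `|Φ(x, b)| ≤ 1/2` always (`Φ = arctan(…)/π ∈ (-1/2, 1/2)`).
[cite: AjankiHuveneers2011, Lemma 3.2 eq. (3.10)] -/
theorem abs_ahPhi_le_half (w x b : ℝ) : |ahPhi w x b| ≤ 1 / 2 := by
  unfold ahPhi
  have h1 := Real.arctan_lt_pi_div_two (ahNum w x b / ahDen w x b)
  have h2 := Real.neg_pi_div_two_lt_arctan (ahNum w x b / ahDen w x b)
  rw [abs_le]
  constructor
  · rw [show -(1 / 2 : ℝ) = (-(π / 2)) / π by field_simp]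
    exact (div_le_div_of_nonneg_right h2.le Real.pi_pos.le)
  · rw [show (1 / 2 : ℝ) = (π / 2) / π by field_simp]
    exact (div_le_div_of_nonneg_right h1.le Real.pi_pos.le)

/-- **(Φ1)** `|Φ(x,b)| ≤ G w` for `0 < w ≤ w₀`, `b ∈ [b₋, b₊]`, all `x` ("`Φ(x,b) = 𝒪(w)`").
[cite: AjankiHuveneers2011, Lemma 3.2 eq. (3.11)] -/
theorem ahPhi_abs_le_linear :
    ∃ w₀ : ℝ, 0 < w₀ ∧ ∃ G : ℝ, 0 ≤ G ∧ ∀ w ∈ Set.Ioc 0 w₀, ∀ x : ℝ, ∀ b ∈ Set.Icc bm bp,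
      |ahPhi w x b| ≤ G * w := by
  obtain ⟨w₀, hw₀, G, hG0, hG⟩ := ahPhi_abs_le bm bp
  refine ⟨w₀, hw₀, G, hG0, fun w hw x b hb => (hG w hw x b hb).trans ?_⟩
  have : G * w * Real.sin (π * x) ^ 2 ≤ G * w * 1 :=
    mul_le_mul_of_nonneg_left (Real.sin_sq_le_one _) (mul_nonneg hG0 hw.1.le)
  linarith

/-- **(Φ2)** `|Φ(x,b) - Φ(y,b)| ≤ G w (|sin π(x-y)| + w²)` for `0 < w ≤ w₀`, `b ∈ [b₋, b₊]`: the
`x`-Lipschitz bound on `Φ` in the circle metric, up to the `𝒪(w³)` remainder of (3.11)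
(`|φ(x) - φ(y)|, |ψ(x) - ψ(y)| ≲ |sin π(x-y)|`). [cite: AjankiHuveneers2011, Lemma 3.2 eq. (3.11)
and proof of Lemma 5.3] -/
theorem ahPhi_sub_ahPhi_le :
    ∃ w₀ : ℝ, 0 < w₀ ∧ ∃ G : ℝ, 0 ≤ G ∧ ∀ w ∈ Set.Ioc 0 w₀, ∀ x y : ℝ, ∀ b ∈ Set.Icc bm bp,
      |ahPhi w x b - ahPhi w y b| ≤ G * w * (|Real.sin (π * (x - y))| + w ^ 2) := by
  obtain ⟨w₀, hw₀, C, hC⟩ := ahPhi_expansion bm bp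
  set M := max |bm| |bp| with hM
  have hM0 : 0 ≤ M := le_max_of_le_left (abs_nonneg _)
  refine ⟨min w₀ 1, by positivity, M + π * M ^ 2 + 2 * |C| * M, by positivity, ?_⟩
  intro w hw x y b hb
  obtain ⟨hw0, hw1⟩ := hw
  have hwa : w ≤ w₀ := hw1.trans (min_le_left _ _)
  have hw1' : w ≤ 1 := hw1.trans (min_le_right _ _)
  have hbM : |b| ≤ M := ReducedLawHyp.abs_le_of_mem hb
  have hb2 : b ^ 2 ≤ M ^ 2 := by
    rw [← sq_abs b]
    exact pow_le_pow_left₀ (abs_nonneg b) hbM 2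
  have ex := hC w ⟨hw0, hwa⟩ x b hb
  have ey := hC w ⟨hw0, hwa⟩ y b hb
  set s := |Real.sin (π * (x - y))| with hs
  have hs0 : 0 ≤ s := abs_nonneg _
  set Px := Real.sin (π * x) ^ 2 * (w * b + w ^ 2 * b ^ 2 * (π / 2) * Real.sin (2 * π * x)) with hPx
  set Py := Real.sin (π * y) ^ 2 * (w * b + w ^ 2 * b ^ 2 * (π / 2) * Real.sin (2 * π * y)) with hPy
  have h1 := abs_sin_sq_sub_sin_sq_le x y
  have h2 := abs_sin_sq_mul_sin_sub_le x y
  have hP1 : |w * b * (Real.sin (π * x) ^ 2 - Real.sin (π * y) ^ 2)| ≤ w * M * s := by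
    rw [abs_mul, abs_mul, abs_of_pos hw0]
    exact mul_le_mul (mul_le_mul_of_nonneg_left hbM hw0.le) h1 (abs_nonneg _) (by positivity)
  have hP2 : |w ^ 2 * b ^ 2 * (π / 2) *
      (Real.sin (π * x) ^ 2 * Real.sin (2 * π * x) - Real.sin (π * y) ^ 2 * Real.sin (2 * π * y))|
        ≤ w ^ 2 * M ^ 2 * (π / 2) * (2 * s) := by
    rw [abs_mul, abs_of_nonneg (by positivity : (0:ℝ) ≤ w ^ 2 * b ^ 2 * (π / 2))]
    exact mul_le_mul (by gcongr) h2 (abs_nonneg _) (by positivity)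
  have hP : |Px - Py| ≤ (w * M + w ^ 2 * M ^ 2 * π) * s := by
    have e : Px - Py = w * b * (Real.sin (π * x) ^ 2 - Real.sin (π * y) ^ 2) +
        w ^ 2 * b ^ 2 * (π / 2) *
          (Real.sin (π * x) ^ 2 * Real.sin (2 * π * x) - Real.sin (π * y) ^ 2 * Real.sin (2 * π * y)) := by
      rw [hPx, hPy]; ring
    rw [e]
    refine (abs_add_le _ _).trans ?_
    nlinarith [hP1, hP2]
  have hEx : |ahPhi w x b - Px| ≤ |C| * w ^ 3 * M := by
    refine ex.trans ?_
    calc C * w ^ 3 * |b| * Real.sin (π * x) ^ 2 ≤ |C| * w ^ 3 * |b| * Real.sin (π * x) ^ 2 := by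
          gcongr; exact le_abs_self C
      _ ≤ |C| * w ^ 3 * M * 1 := by
          gcongr
          exact Real.sin_sq_le_one _
      _ = |C| * w ^ 3 * M := by ring
  have hEy : |ahPhi w y b - Py| ≤ |C| * w ^ 3 * M := by
    refine ey.trans ?_
    calc C * w ^ 3 * |b| * Real.sin (π * y) ^ 2 ≤ |C| * w ^ 3 * |b| * Real.sin (π * y) ^ 2 := by
          gcongr; exact le_abs_self C
      _ ≤ |C| * w ^ 3 * M * 1 := by
          gcongr
          exact Real.sin_sq_le_one _
      _ = |C| * w ^ 3 * M := by ring
  have e2 : ahPhi w x b - ahPhi w y b = (ahPhi w x b - Px) - (ahPhi w y b - Py) + (Px - Py) := by ring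
  rw [e2]
  calc |(ahPhi w x b - Px) - (ahPhi w y b - Py) + (Px - Py)|
      ≤ |ahPhi w x b - Px| + |ahPhi w y b - Py| + |Px - Py| := by
        refine (abs_add_le _ _).trans ?_
        gcongr
        exact abs_sub _ _
    _ ≤ |C| * w ^ 3 * M + |C| * w ^ 3 * M + (w * M + w ^ 2 * M ^ 2 * π) * s := by gcongr
    _ ≤ (M + π * M ^ 2 + 2 * |C| * M) * w * (s + w ^ 2) := by
        have hw2 : w ^ 2 ≤ w := by nlinarith
        have k1 : 0 ≤ π * M ^ 2 * s * (w - w ^ 2) :=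
          mul_nonneg (by positivity) (by linarith)
        have k2 : 0 ≤ 2 * |C| * M * w * s := by positivity
        have k3 : 0 ≤ (M + π * M ^ 2) * w ^ 3 := by positivity
        have e : (M + π * M ^ 2 + 2 * |C| * M) * w * (s + w ^ 2) -
            (|C| * w ^ 3 * M + |C| * w ^ 3 * M + (w * M + w ^ 2 * M ^ 2 * π) * s) =
            π * M ^ 2 * s * (w - w ^ 2) + 2 * |C| * M * w * s + (M + π * M ^ 2) * w ^ 3 := by ring
        linarith

/-- **(Φ3)** The first-order term: `|∫ (Φ(x,b) - Φ(y,b))(1 + w a b) τ(b) db| ≤ G w²(|sin π(x-y)| + w)`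
for `|a| ≤ A`, `0 < w ≤ w₀(A)` — the `𝒪(w)` part `w(φ(x) - φ(y)) b` integrates to zero against `τ`
("taking into account … the fact that `∫ b τ(b) db = 0`").
[cite: AjankiHuveneers2011, proof of Lemma 5.3 and Lemma 3.2 eq. (3.11)] -/
theorem ahPhi_sub_integral_le (hτ : ReducedLawHyp τ bm bp) {A : ℝ} (hA : 0 ≤ A) :
    ∃ w₀ : ℝ, 0 < w₀ ∧ ∃ G : ℝ, 0 ≤ G ∧ ∀ w ∈ Set.Ioc 0 w₀, ∀ a : ℝ, |a| ≤ A → ∀ x y : ℝ,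
      |∫ b, (ahPhi w x b - ahPhi w y b) * ((1 + w * a * b) * τ b)| ≤
        G * w ^ 2 * (|Real.sin (π * (x - y))| + w) := by
  obtain ⟨w₀, hw₀, C, hC⟩ := ahPhi_expansion bm bp
  set M := max |bm| |bp| with hM
  have hM0 : 0 ≤ M := le_max_of_le_left (abs_nonneg _)
  refine ⟨min w₀ (1 / (A * M + 1)), by positivity, A * M ^ 2 + 2 * π * M ^ 2 + 4 * |C| * M,
    by positivity, ?_⟩
  intro w hw a ha x y
  obtain ⟨hw0, hw1⟩ := hw
  have hwa : w ≤ w₀ := hw1.trans (min_le_left _ _)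
  have hwAM : w * A * M ≤ 1 := by
    have h1 : w ≤ 1 / (A * M + 1) := hw1.trans (min_le_right _ _)
    have h2 : w * (A * M + 1) ≤ 1 := by
      calc w * (A * M + 1) ≤ 1 / (A * M + 1) * (A * M + 1) := by gcongr
        _ = 1 := by field_simp
    nlinarith [mul_nonneg hA hM0]
  set s := |Real.sin (π * (x - y))| with hs
  have hs0 : 0 ≤ s := abs_nonneg _
  -- the coefficients of the expansion
  set S := Real.sin (π * x) ^ 2 - Real.sin (π * y) ^ 2 with hS
  set Gd := (π / 2) *
    (Real.sin (π * x) ^ 2 * Real.sin (2 * π * x) - Real.sin (π * y) ^ 2 * Real.sin (2 * π * y)) with hGd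
  have hSle : |S| ≤ s := abs_sin_sq_sub_sin_sq_le x y
  have hGdle : |Gd| ≤ π * s := by
    rw [hGd, abs_mul, abs_of_pos (by positivity : (0:ℝ) < π / 2)]
    have := abs_sin_sq_mul_sin_sub_le x y
    nlinarith [Real.pi_pos]
  -- the integrand and its explicit first-order part
  set F : ℝ → ℝ := fun b => (ahPhi w x b - ahPhi w y b) * ((1 + w * a * b) * τ b) with hF
  set F₀ : ℝ → ℝ := fun b => S * w * (b * τ b) with hF₀
  set Kc : ℝ := s * w ^ 2 * (A * M ^ 2 + 2 * π * M ^ 2) + 4 * |C| * M * w ^ 3 with hKc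
  -- pointwise bound
  have hpt : ∀ b, |F b - F₀ b| ≤ Kc * τ b := by
    intro b
    by_cases hb : b ∈ Set.Icc bm bp
    · have hbM : |b| ≤ M := ReducedLawHyp.abs_le_of_mem hb
      have hb2 : b ^ 2 ≤ M ^ 2 := by
        rw [← sq_abs b]; exact pow_le_pow_left₀ (abs_nonneg b) hbM 2
      have hτ0 : 0 ≤ τ b := hτ.nonneg b
      set Ex := ahPhi w x b -
        Real.sin (π * x) ^ 2 * (w * b + w ^ 2 * b ^ 2 * (π / 2) * Real.sin (2 * π * x)) with hEx
      set Ey := ahPhi w y b -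
        Real.sin (π * y) ^ 2 * (w * b + w ^ 2 * b ^ 2 * (π / 2) * Real.sin (2 * π * y)) with hEy
      have hExb : |Ex| ≤ |C| * w ^ 3 * M := by
        refine (hC w ⟨hw0, hwa⟩ x b hb).trans ?_
        calc C * w ^ 3 * |b| * Real.sin (π * x) ^ 2 ≤ |C| * w ^ 3 * |b| * Real.sin (π * x) ^ 2 := by
              gcongr; exact le_abs_self C
          _ ≤ |C| * w ^ 3 * M * 1 := by
              gcongr
              exact Real.sin_sq_le_one _
          _ = |C| * w ^ 3 * M := by ring
      have hEyb : |Ey| ≤ |C| * w ^ 3 * M := by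
        refine (hC w ⟨hw0, hwa⟩ y b hb).trans ?_
        calc C * w ^ 3 * |b| * Real.sin (π * y) ^ 2 ≤ |C| * w ^ 3 * |b| * Real.sin (π * y) ^ 2 := by
              gcongr; exact le_abs_self C
          _ ≤ |C| * w ^ 3 * M * 1 := by
              gcongr
              exact Real.sin_sq_le_one _
          _ = |C| * w ^ 3 * M := by ring
      have hwght : |1 + w * a * b| ≤ 2 := by
        have : |w * a * b| ≤ 1 := by
          rw [abs_mul, abs_mul, abs_of_pos hw0]
          calc w * |a| * |b| ≤ w * A * M := by gcongr
            _ ≤ 1 := hwAM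
        calc |1 + w * a * b| ≤ |(1:ℝ)| + |w * a * b| := abs_add_le _ _
          _ ≤ 1 + 1 := by rw [abs_one]; gcongr
          _ = 2 := by norm_num
      have e : F b - F₀ b =
          (S * w ^ 2 * a * b ^ 2 + Gd * w ^ 2 * b ^ 2 * (1 + w * a * b) +
            (Ex - Ey) * (1 + w * a * b)) * τ b := by
        have hD : ahPhi w x b - ahPhi w y b = S * w * b + Gd * w ^ 2 * b ^ 2 + (Ex - Ey) := by
          rw [hEx, hEy, hS, hGd]; ring
        simp only [hF, hF₀]
        rw [hD]; ring
      rw [e, abs_mul, abs_of_nonneg hτ0]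
      refine mul_le_mul_of_nonneg_right ?_ hτ0
      have t1 : |S * w ^ 2 * a * b ^ 2| ≤ s * w ^ 2 * A * M ^ 2 := by
        rw [abs_mul, abs_mul, abs_mul, abs_of_pos (by positivity : (0:ℝ) < w ^ 2),
          abs_of_nonneg (sq_nonneg b)]
        gcongr
      have t2 : |Gd * w ^ 2 * b ^ 2 * (1 + w * a * b)| ≤ π * s * w ^ 2 * M ^ 2 * 2 := by
        rw [abs_mul, abs_mul, abs_mul, abs_of_pos (by positivity : (0:ℝ) < w ^ 2),
          abs_of_nonneg (sq_nonneg b)]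
        gcongr
      have t3 : |(Ex - Ey) * (1 + w * a * b)| ≤ (|C| * w ^ 3 * M + |C| * w ^ 3 * M) * 2 := by
        rw [abs_mul]
        gcongr
        exact (abs_sub _ _).trans (add_le_add hExb hEyb)
      calc |S * w ^ 2 * a * b ^ 2 + Gd * w ^ 2 * b ^ 2 * (1 + w * a * b) + (Ex - Ey) * (1 + w * a * b)|
          ≤ |S * w ^ 2 * a * b ^ 2| + |Gd * w ^ 2 * b ^ 2 * (1 + w * a * b)| +
              |(Ex - Ey) * (1 + w * a * b)| := by
            refine (abs_add_le _ _).trans ?_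
            gcongr
            exact abs_add_le _ _
        _ ≤ s * w ^ 2 * A * M ^ 2 + π * s * w ^ 2 * M ^ 2 * 2 +
              (|C| * w ^ 3 * M + |C| * w ^ 3 * M) * 2 := by gcongr
        _ = Kc := by rw [hKc]; ring
    · have hτb : τ b = 0 := hτ.eq_zero b hb
      simp [hF, hF₀, hτb]
  -- integrability
  have hFint : Integrable F := by
    have e : F = fun b => ((ahPhi w x b - ahPhi w y b) * (1 + w * a * b)) * τ b := by
      funext b; simp only [hF]; ring
    rw [e]
    refine hτ.integrable_mul ?_ (C := (1 / 2 + 1 / 2) * 2) ?_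
    · refine Measurable.aestronglyMeasurable ?_
      refine ((measurable_ahPhi_right w x).sub (measurable_ahPhi_right w y)).mul ?_
      exact measurable_const.add (measurable_const.mul measurable_id)
    · intro b hb
      have hbM : |b| ≤ M := ReducedLawHyp.abs_le_of_mem hb
      rw [abs_mul]
      refine mul_le_mul ((abs_sub _ _).trans (add_le_add (abs_ahPhi_le_half _ _ _)
        (abs_ahPhi_le_half _ _ _))) ?_ (abs_nonneg _) (by norm_num)
      have : |w * a * b| ≤ 1 := by
        rw [abs_mul, abs_mul, abs_of_pos hw0]
        calc w * |a| * |b| ≤ w * A * M := by gcongr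
          _ ≤ 1 := hwAM
      calc |1 + w * a * b| ≤ |(1:ℝ)| + |w * a * b| := abs_add_le _ _
        _ ≤ 1 + 1 := by rw [abs_one]; gcongr
        _ = 2 := by norm_num
  have hF₀int : Integrable F₀ := hτ.integrable_id_mul.const_mul (S * w)
  have hF₀zero : ∫ b, F₀ b = 0 := by
    simp only [hF₀]
    rw [integral_const_mul, hτ.mean_zero, mul_zero]
  have hsplit : ∫ b, F b = ∫ b, (F b - F₀ b) := by
    rw [integral_sub hFint hF₀int, hF₀zero, sub_zero]
  have hbound : |∫ b, (F b - F₀ b)| ≤ Kc := by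
    have h1 : ‖∫ b, (F b - F₀ b)‖ ≤ ∫ b, Kc * τ b :=
      norm_integral_le_of_norm_le (hτ.integrable.const_mul Kc)
        (ae_of_all _ fun b => by rw [Real.norm_eq_abs]; exact hpt b)
    rw [integral_const_mul, hτ.integral_eq_one, mul_one, Real.norm_eq_abs] at h1
    exact h1
  show |∫ b, F b| ≤ _
  rw [hsplit]
  refine hbound.trans ?_
  rw [hKc]
  have hw3 : 0 ≤ w ^ 3 := by positivity
  nlinarith [mul_nonneg (mul_nonneg hs0 (sq_nonneg w)) (by positivity : (0:ℝ) ≤ 4 * |C| * M),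
    mul_nonneg hw3 (by positivity : (0:ℝ) ≤ A * M ^ 2 + 2 * π * M ^ 2)]

end PhiBounds


/-! ### Boundedness and integrability plumbing -/

section Plumbing

variable {τ : ℝ → ℝ} {bm bp : ℝ}

/-- A continuous `1`-periodic function is bounded. [folklore] -/
theorem periodic_continuous_bounded {u : ℝ → ℝ} (hp : Function.Periodic u 1) (hc : Continuous u) :
    ∃ U : ℝ, 0 ≤ U ∧ ∀ z, |u z| ≤ U := by
  obtain ⟨C, hC⟩ := isBounded_iff_forall_norm_le.mp (hp.isBounded_of_continuous one_ne_zero hc)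
  refine ⟨max C 0, le_max_right _ _, fun z => ?_⟩
  have := hC (u z) ⟨z, rfl⟩
  rw [Real.norm_eq_abs] at this
  exact this.trans (le_max_left _ _)

/-- The derivative of a `1`-periodic function is `1`-periodic. [folklore] -/
theorem periodic_deriv_one {u : ℝ → ℝ} (hp : Function.Periodic u 1) :
    Function.Periodic (deriv u) 1 := by
  intro z
  have hfun : (fun s => u (s + 1)) = u := funext hp
  rw [← deriv_comp_add_const, hfun]

/-- Integrability of `b ↦ g(b) (1 + w a b) τ(b)` for bounded measurable `g` (the integrands of
`T`, `T_y` and of the first-order term). [folklore] -/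
theorem integrable_weighted (hτ : ReducedLawHyp τ bm bp) {g : ℝ → ℝ} (hg : Measurable g)
    {U : ℝ} (hU : ∀ b, |g b| ≤ U) (w a : ℝ) :
    Integrable fun b => g b * ((1 + w * a * b) * τ b) := by
  have e : (fun b => g b * ((1 + w * a * b) * τ b)) = fun b => (g b * (1 + w * a * b)) * τ b := by
    funext b; ring
  rw [e]
  refine hτ.integrable_mul (C := U * (1 + |w| * |a| * max |bm| |bp|))
    (hg.mul (measurable_const.add (measurable_const.mul measurable_id))).aestronglyMeasurable ?_
  intro b hb
  have hbM : |b| ≤ max |bm| |bp| := ReducedLawHyp.abs_le_of_mem hb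
  rw [abs_mul]
  refine mul_le_mul (hU b) ?_ (abs_nonneg _) ((abs_nonneg _).trans (hU b))
  calc |1 + w * a * b| ≤ |(1:ℝ)| + |w * a * b| := abs_add_le _ _
    _ = 1 + |w| * |a| * |b| := by rw [abs_one, abs_mul, abs_mul]
    _ ≤ 1 + |w| * |a| * max |bm| |bp| := by gcongr

end Plumbing

end Literature.Barriers.AtomisticToContinuum.HeatConduction

namespace Literature.Barriers.AtomisticToContinuum

open Literature.MathematicalPhysics.KineticTheory.HeatConduction HeatConduction

/-! ### The corrected Lemma 5.3 -/

/-- **Lemma 5.3 (estimates on `R_y`), eq. (5.12), CORRECTED.** The printed statement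
(`AjankiHuveneers2011_RyEstimate`: "`‖R_y u‖_∞ ≤ K w² {‖sin π(·-y-w) · u'‖_∞ + w‖u'‖_∞ +
‖sin² π(·-y-w) · u''‖_∞ + w‖u''‖_∞}` for every `u ∈ C²(𝕋)`, `y ∈ 𝕋`") is false: its proof's
(5.13) mislocates the mean-value point (`ξ₁ = 𝒪(w)`, not `𝒪(w|φ(x)-φ(y)| + w²)`), and
`u = cos^{2N}(π(· - x - ϑ))`, `N = t⁻²`, `y = x - t`, `w = t³`, `h = 0` violates the bound by a factor
`≳ 1/t` (module docstring). What the (repaired) proof gives, and what is stated here, is the same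
bound with ONE power of the sine on `u''`:
`‖R_y u‖_∞ ≤ K w² {‖sin π(·-y-w) · u'‖_∞ + w‖u'‖_∞ + ‖sin π(·-y-w) · u''‖_∞ + w‖u''‖_∞}`,
for `w ∈ (0, w₀]`, `K`, `w₀` depending on `h`, `τ`; the four sup-norms rendered by arbitrary
majorants `A₁, A₁', A₂, A₂'` exactly as in the printed fact. Proved: `…_holds`.
[cite: AjankiHuveneers2011, Lemma 5.3 eq. (5.12) (corrected: `sin` for `sin²` in the `u''` term)] -/
def AjankiHuveneers2011_RyEstimateCorrected : Prop :=
  ∀ (τ : ℝ → ℝ) (bm bp : ℝ), ReducedLawHyp τ bm bp →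
    ∀ h : ℝ → ℝ, Function.Periodic h 1 → ContDiff ℝ 1 h →
      ∃ w₀ : ℝ, 0 < w₀ ∧ ∃ K : ℝ, 0 < K ∧ ∀ w ∈ Set.Ioc 0 w₀,
        ∀ u : ℝ → ℝ, Function.Periodic u 1 → ContDiff ℝ 2 u → ∀ y : ℝ, ∀ A₁ A₁' A₂ A₂' : ℝ,
          (∀ z, |Real.sin (π * (z - y - w)) * deriv u z| ≤ A₁) → (∀ z, |deriv u z| ≤ A₁') →
          (∀ z, |Real.sin (π * (z - y - w)) * iteratedDeriv 2 u z| ≤ A₂) →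
          (∀ z, |iteratedDeriv 2 u z| ≤ A₂') →
            ∀ x, |ahRy τ w h y u x| ≤ K * w ^ 2 * (A₁ + w * A₁' + A₂ + w * A₂')

-- names the `@[deprecated]` record `AjankiHuveneers2011_RyEstimate` of `DisorderedHarmonicChainPotential.lean`
-- on purpose: it records that the restatement is not stronger than the printed lemma (verdict clean-up
-- 2026-08-16); REMOVE-WHEN the record is deleted there
set_option linter.deprecated false in
/-- The printed (5.12) is formally stronger than the corrected statement: `sin² ≤ |sin|`, so a
majorant of `|sin π(·-y-w) u''|` is a majorant of `sin² π(·-y-w) |u''|`. (The hypothesis is the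
refuted, `@[deprecated]` record of `DisorderedHarmonicChainPotential.lean`: this implication is
vacuously true and is kept only as the check that the corrected statement does not claim more than
the printed one.)
[cite: AjankiHuveneers2011, Lemma 5.3 eq. (5.12)] -/
theorem AjankiHuveneers2011_RyEstimate.corrected (hR : AjankiHuveneers2011_RyEstimate) :
    AjankiHuveneers2011_RyEstimateCorrected := by
  intro τ bm bp hτ h hh hh1
  obtain ⟨w₀, hw₀, K, hK, hmain⟩ := hR τ bm bp hτ h hh hh1
  refine ⟨w₀, hw₀, K, hK, fun w hw u hu hu2 y A₁ A₁' A₂ A₂' h1 h1' h2 h2' x => ?_⟩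
  refine hmain w hw u hu hu2 y A₁ A₁' A₂ A₂' h1 h1' (fun z => ?_) h2' x
  calc |Real.sin (π * (z - y - w)) ^ 2 * iteratedDeriv 2 u z|
      = |Real.sin (π * (z - y - w))| * |Real.sin (π * (z - y - w)) * iteratedDeriv 2 u z| := by
        rw [abs_mul, abs_mul, abs_pow, pow_two]; ring
    _ ≤ 1 * |Real.sin (π * (z - y - w)) * iteratedDeriv 2 u z| := by
        gcongr; exact Real.abs_sin_le_one _
    _ ≤ A₂ := by rw [one_mul]; exact h2 z

set_option maxHeartbeats 800000 in -- one long bookkeeping proof (three MVT points, four majorants)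
/-- **The corrected Lemma 5.3, PROVED.** `R_y u(x) = A₁ + A₂` with
`A₁ = ∫ (u∘f_b(x) - u∘g_b(x,y))(1 + wh(x)b) τ(b) db`, `A₂ = w(h(x) - h(y)) ∫ u∘g_b(x,y) b τ(b) db`;
mean value theorem twice around `c = x + ϑ`, `|Φ| ≲ w`, `|Φ(x,b) - Φ(y,b)| ≲ w(|sin π(x-y)| + w²)`,
`|∫ (Φ(x,b) - Φ(y,b)) τ̃(b) db| ≲ w²(|sin π(x-y)| + w)` and `∫ b τ = 0`, `|h(x) - h(y)| ≲ |sin π(x-y)|`,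
and `|sin π(x-y)| ≤ |sin π(θ-y-w)| + π|x + w - θ|` for the intermediate points `θ = x + w + 𝒪(w)`.
[cite: AjankiHuveneers2011, Lemma 5.3 eq. (5.12) and its proof (corrected)] -/
theorem AjankiHuveneers2011_RyEstimateCorrected_holds : AjankiHuveneers2011_RyEstimateCorrected := by
  intro τ bm bp hτ h hh hh1
  -- constants attached to `τ`
  set M := max |bm| |bp| with hM
  have hM0 : 0 ≤ M := le_max_of_le_left (abs_nonneg _)
  -- constants attached to `h`
  have hhd : Differentiable ℝ h := hh1.differentiable one_ne_zero
  obtain ⟨H, hH0, hH⟩ := periodic_continuous_bounded hh hh1.continuous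
  obtain ⟨L, hL0, hL⟩ :=
    periodic_continuous_bounded (periodic_deriv_one hh) (hh1.continuous_deriv le_rfl)
  -- constants attached to `Φ`
  obtain ⟨w₁, hw₁, G₁, hG₁, hΦ1⟩ := ahPhi_abs_le_linear bm bp
  obtain ⟨w₂, hw₂, G₂, hG₂, hΦ2⟩ := ahPhi_sub_ahPhi_le bm bp
  obtain ⟨w₃, hw₃, G₃, hG₃, hΦ3⟩ := ahPhi_sub_integral_le bm bp hτ hH0
  -- the constants of the lemma
  set K₁ : ℝ := G₃ * (π + 1) + L / 2 * G₁ * M * (π * (G₁ + 1)) with hK₁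
  set K₂ : ℝ := 2 * G₁ * G₂ * (π * (G₁ + 1) + 1) with hK₂
  have hK₁0 : 0 ≤ K₁ := by positivity
  have hK₂0 : 0 ≤ K₂ := by positivity
  refine ⟨min (min w₁ w₂) (min w₃ (min (1 / 5) (1 / (H * M + 1)))), by positivity,
    K₁ + K₂ + 1, by positivity, ?_⟩
  intro w hw u hu hu2 y A₁ A₁' A₂ A₂' h1 h1' h2 h2' x
  obtain ⟨hw0, hwle⟩ := hw
  have hw₁' : w ≤ w₁ := hwle.trans ((min_le_left _ _).trans (min_le_left _ _))
  have hw₂' : w ≤ w₂ := hwle.trans ((min_le_left _ _).trans (min_le_right _ _))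
  have hw₃' : w ≤ w₃ := hwle.trans ((min_le_right _ _).trans (min_le_left _ _))
  have hw5 : w ≤ 1 / 5 :=
    hwle.trans ((min_le_right _ _).trans ((min_le_right _ _).trans (min_le_left _ _)))
  have hwH : w ≤ 1 / (H * M + 1) :=
    hwle.trans ((min_le_right _ _).trans ((min_le_right _ _).trans (min_le_right _ _)))
  have hw1 : w ≤ 1 := by linarith
  have hwHM : w * H * M ≤ 1 := by
    have h2 : w * (H * M + 1) ≤ 1 := by
      calc w * (H * M + 1) ≤ 1 / (H * M + 1) * (H * M + 1) := by gcongr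
        _ = 1 := by field_simp
    have e : w * H * M = w * (H * M + 1) - w := by ring
    rw [e]
    linarith
  -- nonnegativity of the majorants
  have hA₁ : 0 ≤ A₁ := (abs_nonneg _).trans (h1 0)
  have hA₁' : 0 ≤ A₁' := (abs_nonneg _).trans (h1' 0)
  have hA₂ : 0 ≤ A₂ := (abs_nonneg _).trans (h2 0)
  have hA₂' : 0 ≤ A₂' := (abs_nonneg _).trans (h2' 0)
  -- `u`, `u'`, `u''`
  have hud : Differentiable ℝ u := hu2.differentiable two_ne_zero
  have hud2 : Differentiable ℝ (deriv u) := hu2.differentiable_deriv_two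
  have hider : iteratedDeriv 2 u = deriv (deriv u) := by
    rw [show (2 : ℕ) = 1 + 1 from rfl, iteratedDeriv_succ, iteratedDeriv_one]
  rw [hider] at h2 h2'
  obtain ⟨U, hU0, hU⟩ := periodic_continuous_bounded hu hu2.continuous
  -- `ϑ = w + 𝒪(w³)`
  have hϑlo : w ≤ ahTheta w := ahTheta_ge hw0.le (by nlinarith [Real.pi_le_four])
  have hϑhi : ahTheta w ≤ w + w ^ 3 := ahTheta_le hw0.le hw5
  have hϑ1 : |ahTheta w - w| ≤ w := by
    rw [abs_of_nonneg (by linarith)]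
    have hw3 : w ^ 3 ≤ w := pow_le_of_le_one hw0.le hw1 three_ne_zero
    linarith
  -- the centre `c = x + ϑ` and the sine weight at `x`
  set c : ℝ := x + ahTheta w with hc
  set s₀ : ℝ := |Real.sin (π * (x - y))| with hs₀
  have hs₀0 : 0 ≤ s₀ := abs_nonneg _
  have hshift : ∀ z v : ℝ, |z - c| ≤ G₁ * w →
      s₀ * |v| ≤ |Real.sin (π * (z - y - w)) * v| + π * ((G₁ + 1) * w) * |v| := by
    intro z v hz
    have h1 := abs_sin_mul_le_shift x y w z v
    have h2 : |x + w - z| ≤ (G₁ + 1) * w := by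
      have e : x + w - z = (c - z) - (ahTheta w - w) := by rw [hc]; ring
      rw [e]
      calc |(c - z) - (ahTheta w - w)| ≤ |c - z| + |ahTheta w - w| := abs_sub _ _
        _ ≤ G₁ * w + w := by rw [abs_sub_comm]; exact add_le_add hz hϑ1
        _ = (G₁ + 1) * w := by ring
    have h3 : π * |x + w - z| * |v| ≤ π * ((G₁ + 1) * w) * |v| := by gcongr
    linarith
  -- the integrands
  set F₁ : ℝ → ℝ := fun b => u (ahStep w b x) * ((1 + w * h x * b) * τ b) with hF₁
  set F₂ : ℝ → ℝ := fun b => u (ahG w b x y) * ((1 + w * h y * b) * τ b) with hF₂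
  set P : ℝ → ℝ := fun b => (ahPhi w x b - ahPhi w y b) * ((1 + w * h x * b) * τ b) with hP
  set R : ℝ → ℝ := fun b =>
    F₁ b - F₂ b - deriv u c * P b - w * (h x - h y) * u c * (b * τ b) with hR
  -- integrability
  have iF₁ : Integrable F₁ :=
    integrable_weighted hτ (hu2.continuous.measurable.comp (measurable_ahStep_right w x))
      (fun b => hU _) w (h x)
  have hmeasG : Measurable fun b => ahG w b x y := by
    show Measurable fun b => x + ahTheta w + ahPhi w y b
    exact measurable_const.add (measurable_ahPhi_right w y)
  have iF₂ : Integrable F₂ :=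
    integrable_weighted hτ (hu2.continuous.measurable.comp hmeasG) (fun b => hU _) w (h y)
  have iP : Integrable P := by
    refine integrable_weighted hτ ((measurable_ahPhi_right w x).sub (measurable_ahPhi_right w y))
      (U := 1 / 2 + 1 / 2) (fun b => ?_) w (h x)
    exact (abs_sub _ _).trans (add_le_add (abs_ahPhi_le_half _ _ _) (abs_ahPhi_le_half _ _ _))
  have iQ : Integrable fun b : ℝ => b * τ b := hτ.integrable_id_mul
  have iR : Integrable R :=
    ((iF₁.sub iF₂).sub (iP.const_mul _)).sub (iQ.const_mul _)
  -- the decomposition `R_y u(x) = ∫ R + u'(c) ∫ P + w(h x - h y) u(c) ∫ b τ`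
  have hRy : ahRy τ w h y u x = (∫ b, F₁ b) - ∫ b, F₂ b := rfl
  have hdecomp : ahRy τ w h y u x = (∫ b, R b) + deriv u c * ∫ b, P b := by
    rw [hRy]
    have e1 : ∫ b, R b = (((∫ b, F₁ b) - ∫ b, F₂ b) - deriv u c * ∫ b, P b) -
        w * (h x - h y) * u c * ∫ b, b * τ b := by
      have i12 : Integrable (fun b => F₁ b - F₂ b) := iF₁.sub iF₂
      have iP' : Integrable (fun b => deriv u c * P b) := iP.const_mul _
      have i123 : Integrable (fun b => F₁ b - F₂ b - deriv u c * P b) := i12.sub iP'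
      have i4 : Integrable (fun b => w * (h x - h y) * u c * (b * τ b)) := iQ.const_mul _
      simp only [hR]
      rw [integral_sub i123 i4, integral_sub i12 iP', integral_sub iF₁ iF₂,
        integral_const_mul, integral_const_mul]
    rw [e1, hτ.mean_zero, mul_zero, sub_zero]
    ring
  -- the first-order term
  have hPbound : |deriv u c| * |∫ b, P b| ≤ G₃ * w ^ 2 * (A₁ + (π + 1) * w * A₁') := by
    have h1P : |∫ b, P b| ≤ G₃ * w ^ 2 * (s₀ + w) := hΦ3 w ⟨hw0, hw₃'⟩ (h x) (hH x) x y
    have hsc : s₀ * |deriv u c| ≤ A₁ + π * w * A₁' := by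
      have e : Real.sin (π * (x - y)) = Real.sin (π * (c - y - w) - π * (ahTheta w - w)) := by
        rw [hc]; ring_nf
      have h3 := abs_sin_mul_le_shift x y w c (deriv u c)
      have h4 : |x + w - c| ≤ w := by
        rw [hc, show x + w - (x + ahTheta w) = -(ahTheta w - w) by ring, abs_neg]; exact hϑ1
      have h5 : π * |x + w - c| * |deriv u c| ≤ π * w * A₁' := by gcongr; exact h1' c
      linarith [h1 c]
    calc |deriv u c| * |∫ b, P b| ≤ |deriv u c| * (G₃ * w ^ 2 * (s₀ + w)) := by gcongr
      _ = G₃ * w ^ 2 * (s₀ * |deriv u c| + w * |deriv u c|) := by ring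
      _ ≤ G₃ * w ^ 2 * ((A₁ + π * w * A₁') + w * A₁') := by gcongr; exact h1' c
      _ = G₃ * w ^ 2 * (A₁ + (π + 1) * w * A₁') := by ring
  -- the pointwise bound on the remainder
  set KR : ℝ := 2 * (G₁ * G₂ * w ^ 2 * (A₂ + (π * (G₁ + 1) + 1) * w * A₂')) +
    L / 2 * G₁ * M * w ^ 2 * (A₁ + π * (G₁ + 1) * w * A₁') with hKR
  have hKR0 : 0 ≤ KR := by positivity
  have hpt : ∀ b, |R b| ≤ KR * τ b := by
    intro b
    by_cases hb : b ∈ Set.Icc bm bp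
    · have hτb : 0 ≤ τ b := hτ.nonneg b
      have hbM : |b| ≤ M := ReducedLawHyp.abs_le_of_mem hb
      -- the two evaluation points `a = g_b(x,y)` and `a + d = f_b(x)`
      set a : ℝ := ahG w b x y with ha
      set d : ℝ := ahPhi w x b - ahPhi w y b with hd
      have hac : a - c = ahPhi w y b := by rw [ha, hc]; unfold ahG; ring
      have hadc : a + d - c = ahPhi w x b := by rw [ha, hd, hc]; unfold ahG; ring
      have hstep : ahStep w b x = a + d := by rw [ha, hd]; unfold ahStep ahG; ring
      have hΦx : |ahPhi w x b| ≤ G₁ * w := hΦ1 w ⟨hw0, hw₁'⟩ x b hb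
      have hΦy : |ahPhi w y b| ≤ G₁ * w := hΦ1 w ⟨hw0, hw₁'⟩ y b hb
      have hdle : |d| ≤ G₂ * w * (s₀ + w ^ 2) := hΦ2 w ⟨hw0, hw₂'⟩ x y b hb
      -- mean value theorem, three times
      obtain ⟨θ₁, hθ₁, e₁⟩ := exists_deriv_mul_sub_of_differentiable hud (a + d) a
      obtain ⟨θ₂, hθ₂, e₂⟩ := exists_deriv_mul_sub_of_differentiable hud2 θ₁ c
      obtain ⟨θ₃, hθ₃, e₃⟩ := exists_deriv_mul_sub_of_differentiable hud a c
      have hθ₁c : |θ₁ - c| ≤ G₁ * w := by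
        refine (abs_sub_le_max_of_mem_uIcc hθ₁ c).trans (max_le ?_ ?_)
        · rw [hadc]; exact hΦx
        · rw [hac]; exact hΦy
      have hθ₂c : |θ₂ - c| ≤ G₁ * w := by
        refine (abs_sub_le_max_of_mem_uIcc hθ₂ c).trans (max_le hθ₁c ?_)
        rw [sub_self, abs_zero]; positivity
      have hθ₃c : |θ₃ - c| ≤ G₁ * w := by
        refine (abs_sub_le_max_of_mem_uIcc hθ₃ c).trans (max_le ?_ ?_)
        · rw [hac]; exact hΦy
        · rw [sub_self, abs_zero]; positivity
      -- (i) the second-order Taylor remainder around `c`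
      have ei : u (a + d) - u a - deriv u c * d = deriv (deriv u) θ₂ * (θ₁ - c) * d := by
        rw [e₁, add_sub_cancel_left, ← sub_mul, e₂]
      have hi : |u (a + d) - u a - deriv u c * d| ≤
          G₁ * G₂ * w ^ 2 * (A₂ + (π * (G₁ + 1) + 1) * w * A₂') := by
        rw [ei, abs_mul, abs_mul]
        have hv := hshift θ₂ (deriv (deriv u) θ₂) hθ₂c
        have hv' : s₀ * |deriv (deriv u) θ₂| ≤ A₂ + π * ((G₁ + 1) * w) * A₂' := by
          have := h2 θ₂
          have h5 : π * ((G₁ + 1) * w) * |deriv (deriv u) θ₂| ≤ π * ((G₁ + 1) * w) * A₂' := by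
            gcongr; exact h2' θ₂
          linarith
        calc |deriv (deriv u) θ₂| * |θ₁ - c| * |d|
            ≤ |deriv (deriv u) θ₂| * (G₁ * w) * (G₂ * w * (s₀ + w ^ 2)) := by gcongr
          _ = G₁ * G₂ * w ^ 2 * (s₀ * |deriv (deriv u) θ₂| + w ^ 2 * |deriv (deriv u) θ₂|) := by
              ring
          _ ≤ G₁ * G₂ * w ^ 2 * ((A₂ + π * ((G₁ + 1) * w) * A₂') + w ^ 2 * A₂') := by
              gcongr; exact h2' θ₂
          _ ≤ G₁ * G₂ * w ^ 2 * (A₂ + (π * (G₁ + 1) + 1) * w * A₂') := by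
              have hw2 : w ^ 2 * A₂' ≤ w * A₂' :=
                mul_le_mul_of_nonneg_right (pow_le_of_le_one hw0.le hw1 two_ne_zero) hA₂'
              have e : A₂ + (π * (G₁ + 1) + 1) * w * A₂' -
                  ((A₂ + π * ((G₁ + 1) * w) * A₂') + w ^ 2 * A₂') = w * A₂' - w ^ 2 * A₂' := by
                ring
              have : (A₂ + π * ((G₁ + 1) * w) * A₂') + w ^ 2 * A₂' ≤
                  A₂ + (π * (G₁ + 1) + 1) * w * A₂' := by linarith
              exact mul_le_mul_of_nonneg_left this (by positivity)
      -- (ii) the `h(x) - h(y)` term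
      have hii : |w * (h x - h y) * (u a - u c) * b| ≤
          L / 2 * G₁ * M * w ^ 2 * (A₁ + π * (G₁ + 1) * w * A₁') := by
        rw [e₃, abs_mul, abs_mul, abs_mul, abs_mul, abs_of_pos hw0]
        have hhxy : |h x - h y| ≤ L / 2 * s₀ := periodic_abs_sub_le_sin hh hhd hL x y
        have hv := hshift θ₃ (deriv u θ₃) hθ₃c
        have hv' : s₀ * |deriv u θ₃| ≤ A₁ + π * ((G₁ + 1) * w) * A₁' := by
          have := h1 θ₃
          have h5 : π * ((G₁ + 1) * w) * |deriv u θ₃| ≤ π * ((G₁ + 1) * w) * A₁' := by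
            gcongr; exact h1' θ₃
          linarith
        have hac' : |a - c| ≤ G₁ * w := by rw [hac]; exact hΦy
        calc w * |h x - h y| * (|deriv u θ₃| * |a - c|) * |b|
            ≤ w * (L / 2 * s₀) * (|deriv u θ₃| * (G₁ * w)) * M := by gcongr
          _ = L / 2 * G₁ * M * w ^ 2 * (s₀ * |deriv u θ₃|) := by ring
          _ ≤ L / 2 * G₁ * M * w ^ 2 * (A₁ + π * ((G₁ + 1) * w) * A₁') := by gcongr
          _ = L / 2 * G₁ * M * w ^ 2 * (A₁ + π * (G₁ + 1) * w * A₁') := by ring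
      -- the weight
      have hwght : |1 + w * h x * b| ≤ 2 := by
        have : |w * h x * b| ≤ 1 := by
          rw [abs_mul, abs_mul, abs_of_pos hw0]
          calc w * |h x| * |b| ≤ w * H * M := by gcongr; exact hH x
            _ ≤ 1 := hwHM
        calc |1 + w * h x * b| ≤ |(1:ℝ)| + |w * h x * b| := abs_add_le _ _
          _ ≤ 1 + 1 := by rw [abs_one]; gcongr
          _ = 2 := by norm_num
      -- assembling the remainder
      have eR : R b = ((u (a + d) - u a - deriv u c * d) * (1 + w * h x * b) +
          w * (h x - h y) * (u a - u c) * b) * τ b := by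
        simp only [hR, hF₁, hF₂, hP]
        rw [hstep, ← ha, ← hd]
        ring
      rw [eR, abs_mul, abs_of_nonneg hτb]
      refine mul_le_mul_of_nonneg_right ?_ hτb
      calc |(u (a + d) - u a - deriv u c * d) * (1 + w * h x * b) + w * (h x - h y) * (u a - u c) * b|
          ≤ |(u (a + d) - u a - deriv u c * d) * (1 + w * h x * b)| +
              |w * (h x - h y) * (u a - u c) * b| := abs_add_le _ _
        _ = |u (a + d) - u a - deriv u c * d| * |1 + w * h x * b| +
              |w * (h x - h y) * (u a - u c) * b| := by rw [abs_mul]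
        _ ≤ G₁ * G₂ * w ^ 2 * (A₂ + (π * (G₁ + 1) + 1) * w * A₂') * 2 +
              L / 2 * G₁ * M * w ^ 2 * (A₁ + π * (G₁ + 1) * w * A₁') := by gcongr
        _ = KR := by rw [hKR]; ring
    · have hτb : τ b = 0 := hτ.eq_zero b hb
      have : R b = 0 := by simp [hR, hF₁, hF₂, hP, hτb]
      rw [this, hτb, abs_zero, mul_zero]
  have hRbound : |∫ b, R b| ≤ KR := by
    have h1 : ‖∫ b, R b‖ ≤ ∫ b, KR * τ b :=
      norm_integral_le_of_norm_le (hτ.integrable.const_mul KR)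
        (ae_of_all _ fun b => by rw [Real.norm_eq_abs]; exact hpt b)
    rw [integral_const_mul, hτ.integral_eq_one, mul_one, Real.norm_eq_abs] at h1
    exact h1
  -- conclusion
  rw [hdecomp]
  calc |(∫ b, R b) + deriv u c * ∫ b, P b|
      ≤ |∫ b, R b| + |deriv u c * ∫ b, P b| := abs_add_le _ _
    _ = |∫ b, R b| + |deriv u c| * |∫ b, P b| := by rw [abs_mul]
    _ ≤ KR + G₃ * w ^ 2 * (A₁ + (π + 1) * w * A₁') := add_le_add hRbound hPbound
    _ = w ^ 2 * ((L / 2 * G₁ * M + G₃) * A₁ + K₁ * (w * A₁') + 2 * (G₁ * G₂) * A₂ +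
          K₂ * (w * A₂')) := by rw [hKR, hK₁, hK₂]; ring
    _ ≤ w ^ 2 * (K₁ * A₁ + K₁ * (w * A₁') + K₂ * A₂ + K₂ * (w * A₂')) := by
        have hc1 : L / 2 * G₁ * M + G₃ ≤ K₁ := by
          rw [hK₁]
          have hπ1 : (1:ℝ) ≤ π + 1 := by linarith [Real.pi_pos]
          have hπ2 : (1:ℝ) ≤ π * (G₁ + 1) := by
            have := mul_le_mul Real.pi_gt_three.le (by linarith : (1:ℝ) ≤ G₁ + 1) zero_le_one
              Real.pi_pos.le
            linarith
          have a1 := mul_le_mul_of_nonneg_left hπ1 hG₃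
          have a2 := mul_le_mul_of_nonneg_left hπ2 (by positivity : (0:ℝ) ≤ L / 2 * G₁ * M)
          rw [mul_one] at a1 a2
          linarith
        have hc2 : 2 * (G₁ * G₂) ≤ K₂ := by
          rw [hK₂]
          have hπ2 : (1:ℝ) ≤ π * (G₁ + 1) + 1 := by
            have : 0 ≤ π * (G₁ + 1) := by positivity
            linarith
          have a1 := mul_le_mul_of_nonneg_left hπ2 (by positivity : (0:ℝ) ≤ 2 * (G₁ * G₂))
          rw [mul_one] at a1
          linarith
        gcongr
    _ ≤ (K₁ + K₂ + 1) * w ^ 2 * (A₁ + w * A₁' + A₂ + w * A₂') := by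
        have hwA₁ : 0 ≤ w * A₁' := by positivity
        have hwA₂ : 0 ≤ w * A₂' := by positivity
        have e : (K₁ + K₂ + 1) * w ^ 2 * (A₁ + w * A₁' + A₂ + w * A₂') -
            w ^ 2 * (K₁ * A₁ + K₁ * (w * A₁') + K₂ * A₂ + K₂ * (w * A₂')) =
            w ^ 2 * ((K₂ + 1) * A₁ + (K₂ + 1) * (w * A₁') + (K₁ + 1) * A₂ + (K₁ + 1) * (w * A₂')) := by
          ring
        have : 0 ≤ w ^ 2 * ((K₂ + 1) * A₁ + (K₂ + 1) * (w * A₁') + (K₁ + 1) * A₂ +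
            (K₁ + 1) * (w * A₂')) := by positivity
        linarith

end Literature.Barriers.AtomisticToContinuum

end
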